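import Mathlib
import Literature.AlgebraicGeometry.Tropical.TorusCycles
import HarnessLib

/-!
# The tropical Weil family for `K = ℚ(√-δ)`: period matrices, very general members, Weil functional

Statement-level (T0) definitions extending `Literature/AlgebraicGeometry/Tropical/TorusCycles`
(which fixes `δ = 1`: `weilJ`, `frameComplexDet`, `weilFunctional`, `IsWeilGeneric`) from the
Gaussian field to an arbitrary imaginary quadratic order `ℤ[√-δ]`, `δ ≥ 1`, in the SAME coordinates
(`Fin (2 * n)`: real basis `e_k`, `e_{k+n} = √-δ · e_k` of `V = ℂⁿ`, slope lattice `Γ₂ = ℤ²ⁿ`,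
complex coordinates `z_k = x_k + i√δ · x_{k+n}`), so that the effective tropical cycles are literally
the `TropicalTorusCycle (2 * n) n Q` of that file. Sources: I. Zharkov [Zharkov2020TropicalWeil] §2,
pp. 2–4 (the family `Q_{a,b,c,e}` for `ℚ(i)`, `n = 2`, and its Weil classes; the text treats `d = 1`
and remarks that `ℚ(√-d)` is analogous); G. Mikhalkin, I. Zharkov [MikhalkinZharkov2014Eigenwave]
Def. 6.1 (principally polarised tropical torus `V/Γ₁`, tropical structure `Γ₂`, polarization `Q`);
B. van Geemen [vanGeemen1994HodgeAV] §5.2–5.3 (abelian varieties of Weil type for `K = ℚ(√-d)`: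
`K` acts, the polarization `E` satisfies `E(√-d·x, √-d·y) = d·E(x, y)`, the `K`-hermitian form `H`).

* `WeilFamily.J n δ` — multiplication by `√-δ`: `J e_k = e_{k+n}`, `J e_{k+n} = -δ e_k`
  (`J² = -δ`; for `δ = 1` literally `weilJ n`).
* `WeilFamily.Polarization n δ` — a member of the tropical Weil family `𝓛_δ⁺`: a positive definite
  (symmetric) real `2n × 2n` matrix `Q` with `J Q` antisymmetric. Equivalently
  `Q = (δ·Q₀, Q₂; -Q₂, Q₀)`, `Q₀ = Q₀ᵀ ≻ 0`, `Q₂ = -Q₂ᵀ` — `n²` real parameters — and then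
  `Q⁻¹ J Q = -Jᵀ` is integral, i.e. `J` preserves BOTH lattices `Γ₂ = ℤ²ⁿ` and `Γ₁ = Q ℤ²ⁿ`, so
  `ℤ[√-δ]` acts on the principally polarised tropical abelian variety `B_Q = ℝ²ⁿ/Qℤ²ⁿ` (MZ Def. 6.1);
  the hermitian matrix `H = Q₀ - (i/√δ) Q₂` is positive definite iff `Q` is. For `δ = 1` the
  condition is `QJ = JQ`, the family of `TorusCycles`. `Polarization.coord` = the `n²` free
  coordinates; `Polarization.IsVeryGeneral` = they are algebraically independent over `ℚ` (the
  tropical "very general member"; for `δ = 1` the condition `IsWeilGeneric`).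
* `WeilFamily.frameDet n δ L = det_ℂ [ (l_j)_k + i√δ (l_j)_{k+n} ]` and
  `WeilFamily.functional δ Z = Σ_σ w_σ a_σ · (frameDet L_σ)²` — the value on the cycle class
  `[Z] = Σ_σ w_σ a_σ vol_σ ⊗ vol_σ` of the functional `x ⊗ y ↦ dz(x)·dz(y)`,
  `dz = dz₁ ∧ ⋯ ∧ dz_n` (Cauchy–Binet: `dz(vol_σ) = frameDet L_σ`); `dz` spans
  `(⋀ⁿ E₋)^⊥ = ` the dual of the `+i√δ`-eigenline `⋀ⁿE₊` of `J`, so `functional δ Z` is (a non-zero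
  multiple of) the coefficient of `[Z] ⊗ ℂ` on the TROPICAL WEIL LINE `ℓ₊ = ⋀ⁿE₊ ⊗ ⋀ⁿE₊`; for a
  real class the `ℓ₋`-coefficient is its conjugate, and the powers of the polarization class have
  coefficient `0` (they are `U(n)`-invariant, `ℓ₊` transforms by `det²`). So `functional δ Z ≠ 0`
  reads: "the class of `Z` has a non-zero Weil component".

Definitions only; nothing is asserted. NOT here: the eigenwave / tropical Hodge classes (see
`TropicalTorusWeilCycles` for `δ = 1`), intersection numbers, formal families.
-/

noncomputable section

open scoped BigOperators Matrix
open Matrix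

namespace Literature.AlgebraicGeometry.Tropical

namespace WeilFamily

/-- Multiplication by `√-δ` on `ℤ²ⁿ = ℤ[√-δ]ⁿ` in the basis `e_k, e_{k+n} = √-δ·e_k`:
`J e_k = e_{k+n}`, `J e_{k+n} = -δ·e_k` (`k < n`), as a real `2n × 2n` matrix acting on columns;
`J² = -δ`, and `J = weilJ n` for `δ = 1`. [cite: Zharkov2020TropicalWeil, §2 (pp. 2–4)] -/
def J (n δ : ℕ) : Matrix (Fin (2 * n)) (Fin (2 * n)) ℝ :=
  fun a b => if (a : ℕ) = b + n then 1 else if (b : ℕ) = a + n then -(δ : ℝ) else 0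

/-- A member of the **tropical Weil family `𝓛_δ⁺` for `K = ℚ(√-δ)`** in dimension `g = 2n`: a
positive definite symmetric period / polarization matrix `Q` with `J Q` antisymmetric, i.e.
`Q = (δQ₀, Q₂; -Q₂, Q₀)` with `Q₀` symmetric, `Q₂` antisymmetric; then `Q⁻¹ J Q = -Jᵀ` is integral,
so `√-δ` acts on `B_Q = ℝ²ⁿ/Qℤ²ⁿ` preserving the slope lattice `ℤ²ⁿ` and the polarization
(`E(Jx, Jy) = δ E(x, y)`, van Geemen §5.2). Symmetry of `Q` is part of `Matrix.PosDef`.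
[cite: vanGeemen1994HodgeAV, §5.2–5.3] -/
structure Polarization (n δ : ℕ) where
  /-- the period matrix: columns = a basis of `Γ₁ = Qℤ²ⁿ` in the coordinates of `Γ₂ = ℤ²ⁿ` -/
  Q : Matrix (Fin (2 * n)) (Fin (2 * n)) ℝ
  /-- `J Q` is antisymmetric (`Q` is `J`-adapted with multiplier `δ`) -/
  skew : (J n δ * Q)ᵀ = -(J n δ * Q)
  /-- `Q` is positive definite (in particular symmetric): `B_Q` is a tropical abelian variety -/
  posDef : Q.PosDef

namespace Polarization

variable {n δ : ℕ}

/-- The period matrix of a member of the Weil family is invertible (positive definite).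
[cite: MikhalkinZharkov2014Eigenwave, Def. 6.1] -/
instance instInvertible (P : Polarization n δ) : Invertible P.Q :=
  P.posDef.isUnit.invertible

/-- The `n²` free real coordinates of `Q = (δQ₀, Q₂; -Q₂, Q₀)`: for `a ≤ b` the entry
`(Q₀)_{ab} = Q_{a+n, b+n}`, for `b < a` the entry `(Q₂)_{ba} = Q_{b, a+n}`.
[cite: Zharkov2020TropicalWeil, §2 (pp. 2–4)] -/
def coord (P : Polarization n δ) : Fin n × Fin n → ℝ :=
  fun ab => if ab.1 ≤ ab.2 then P.Q ⟨(ab.1 : ℕ) + n, by omega⟩ ⟨(ab.2 : ℕ) + n, by omega⟩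
    else P.Q ⟨(ab.2 : ℕ), by omega⟩ ⟨(ab.1 : ℕ) + n, by omega⟩

/-- **Very general member** of the tropical Weil family: the `n²` free coordinates of `Q` are
algebraically independent over `ℚ` (outside the countable union of proper `ℚ`-subvarieties of
`𝓛_δ ≅ ℝ^{n²}`; for `δ = 1` this is `IsWeilGeneric`). [cite: Zharkov2020TropicalWeil, p. 3] -/
def IsVeryGeneral (P : Polarization n δ) : Prop :=
  AlgebraicIndependent ℚ P.coord

end Polarization

/-- `frameDet n δ L = det_ℂ [ (l_j)_k + i√δ·(l_j)_{k+n} ]_{k,j} = (dz₁ ∧ ⋯ ∧ dz_n)(l₁, …, l_n)` for an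
integer `2n × n` frame `L = (l₁ | ⋯ | l_n)`, complex coordinates `z_k = x_k + i√δ·x_{k+n}` (the
ℂ-linear projection of `V` onto the `+i√δ`-eigenspace `E₊` of `J`, in the basis `pr₊ e_k`); for
`δ = 1` it is `frameComplexDet n L`. [cite: Zharkov2020TropicalWeil, §2 (pp. 2–4)] -/
def frameDet (n δ : ℕ) (L : Matrix (Fin (2 * n)) (Fin n) ℤ) : ℂ :=
  (Matrix.of fun k j : Fin n =>
    ((L ⟨(k : ℕ), by omega⟩ j : ℤ) : ℂ) +
      Complex.I * (Real.sqrt δ : ℂ) * ((L ⟨(k : ℕ) + n, by omega⟩ j : ℤ) : ℂ)).det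

/-- The **Weil functional for `ℚ(√-δ)`** of an effective tropical `n`-cycle `Z` on `B_Q`,
`Q ∈ 𝓛_δ⁺`: `Σ_σ w_σ · a_σ · (frameDet n δ L_σ)²`, the value on the cycle class
`[Z] = Σ_σ w_σ a_σ vol_σ ⊗ vol_σ` (MZ Prop. 4.3) of `x ⊗ y ↦ dz(x)·dz(y)`; up to a non-zero constant
the coefficient of `[Z] ⊗ ℂ` on the tropical Weil line `ℓ₊ = ⋀ⁿE₊ ⊗ ⋀ⁿE₊`, so `≠ 0` iff the class
has a non-zero component on the Weil plane `ℓ₊ ⊕ ℓ₋` (Zharkov's `w₁, w₂` for `n = 2`, `δ = 1`);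
it vanishes on every power of the polarization class. For `δ = 1` it is `weilFunctional Z`.
[cite: Zharkov2020TropicalWeil, §2 (pp. 2–4)] [cite: MikhalkinZharkov2014Eigenwave, Prop. 4.3] -/
def functional {n : ℕ} (δ : ℕ) {Q : Matrix (Fin (2 * n)) (Fin (2 * n)) ℝ}
    (Z : TropicalTorusCycle (2 * n) n Q) : ℂ :=
  ∑ σ, ((Z.cell σ).weight : ℂ) * ((Z.cell σ).latticeVolume : ℂ) * frameDet n δ (Z.cell σ).frame ^ 2

end WeilFamily

end Literature.AlgebraicGeometry.Tropical

end
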